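import Summits.HodgeConjecture.HodgeConjecture.Theses.NoetherLefschetzOneUp
import Summits.HodgeConjecture.HodgeConjecture.Theorems.CurveNetMordellWeilVerticalSupportMiddleUnconditional
import Summits.HodgeConjecture.HodgeConjecture.Theorems.NoetherLefschetzOneUpSummitGrantedFourfoldsStubHodgeBelowLevel
import Literature.AlgebraicGeometry.HodgeTheory.CubicFourfoldHodgeConjectureChowZero
import HarnessLib

/-!
# Crux `SummitGrantedFourfolds` (stmt-HodgeConjecture-14600), line `Sketch` — the SECTOR THEOREMS:
# granted HC(4;2,2), the Hodge conjecture holds for every CH₀-degenerate sixfold; the crux IS the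
# heart of the middle step from level 3 on (helpers, `--supports`)

The crux `SummitGrantedFourfolds` of route `NoetherLefschetzOneUp` (rank 4; shared with route
`CurveNetMordellWeil`) is `HC(4;2,2) → HodgeConjecture` (`Iff.rfl`). Line `Sketch` (one-sided
diagonal, `Cruxes/SummitGrantedFourfolds/Lines/Sketch.lean`) reads it through the tree's level-wise
reduction of the Hodge conjecture to its middle step and the CH₀-dichotomy of that step
(`Theorems.hodgeConjecture_iff_heart`, `Theorems.middleStepChowDegenerate_holds` — Voisin II
Prop. 10.26 in every even dimension over the unconditional Gysin formalism of the complex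
orientations). This file lands what that reading gives AT ONCE, all sorry-free and with no named
fact as hypothesis:

* `hodgeBelowDim_of_levelsBelow` — the middle levels `< m` give the Hodge conjecture in every
  dimension `< 2m` (`Theorems.stub_hodgeBelowLevel`, BFNP Lemma 48 truncated), in the spelling
  `RegimeSplit.HodgeBelowDim (2m)` of the CurveNetMordellWeil regime split;
  `levelsBelow_three_of_hc42` / `hodgeBelowDim_six_of_hc42` — HC(4;2,2) gives all levels `< 3`
  (`algebraicClasses_zero`, Lefschetz `(1,1)`), hence HC in every dimension `≤ 5`.
* `middle_mem_algebraicClasses_of_chowZeroDegenerate_of_levelsBelow` — the card's SECTOR THEOREM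
  `ChowDegenerateRung`: at every level `m ≥ 2`, granted the levels `< m`, every rational
  `(m,m)`-class on a smooth projective `2m`-fold with degenerate `CH₀` is algebraic.
* `chowZeroDegenerate_of_hasChowZeroSupportedInDimLE` — the barrier catalogue's
  `HasChowZeroSupportedInDimLE X d`, `d < dim X`, implies `RegimeSplit.ChowZeroDegenerate X` (the
  generic point has dimension `dim X`).
* `hodgeConjectureFor_six_of_hc42_of_chowZeroDegenerate` — **granted HC(4;2,2), the Hodge conjecture
  holds for every smooth projective complex SIXFOLD with degenerate `CH₀`** (all codimensions);
  `hodgeConjectureFor_six_of_hc42_of_isSmoothHypersurface` — in particular for every smooth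
  hypersurface sixfold `X ⊂ ℙ⁷_ℂ` of degree `1 ≤ e ≤ 6` (cubic … sextic sixfolds: a line through
  every point, `Motives`/`HodgeTheory.hasChowZeroSupportedInDimLE_of_isSmoothHypersurface`).
* `summitGrantedFourfolds_iff_heartFromThree` — **the crux is EQUIVALENT to the heart of the middle
  step from level 3 on**: `SummitGrantedFourfolds ↔ ∀ q ≥ 3, ∀ X` smooth projective of dimension
  `2q` with `CH₀(X)` NOT degenerate, HC in dimensions `< 2q` ⟹ rational `(q,q)`-classes on `X` are
  algebraic (pure logic over the two tree theorems; `HodgeBelowDim (2q)`, `q ≥ 3`, contains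
  HC(4;2,2)).
* `summitGrantedFourfolds_of_transfer_of_supply` — the line's composition with its two registered
  stubs as hypotheses (transfer `stub_oneSidedRung`, supply `stub_oneSidedSupply`).

## References

* [VoisinHodgeII2003] C. Voisin, Hodge Theory and Complex Algebraic Geometry II, Prop. 10.26 and
  the remark following it, Cor. 10.21, Thm. 10.17.
* [BlochSrinivas1983] S. Bloch, V. Srinivas, Amer. J. Math. 105 (1983), Thm. 1.
* [ConteMurre1978] A. Conte, J. P. Murre, Math. Ann. 238 (1978).
* [BrosnanFangNiePearlstein2009] P. Brosnan, H. Fang, Z. Nie, G. Pearlstein, §6 Lemma 48.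
* [KerrPearlstein2011] M. Kerr, G. Pearlstein, §3.1.
* [EsnaultLevineViehweg1997] H. Esnault, M. Levine, E. Viehweg, Duke Math. J. 87 (1997), Lemma 4.2 a).
* [Deligne2000] P. Deligne, The Hodge conjecture, Clay (2000), §1.
-/

-- `Summit.HodgeConjecture.HodgeConjecture.Theorems` is the mandated namespace (single-problem summit),
-- flagged by `linter.dupNamespace`; the lakefile turns the linter off tree-wide, restated here.
set_option linter.dupNamespace false

noncomputable section

namespace Summit.HodgeConjecture.HodgeConjecture.Theorems

open CategoryTheory AlgebraicGeometry MonoidalCategory CartesianMonoidalCategory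
open Literature.AlgebraicGeometry Literature.AlgebraicGeometry.Motives
  Literature.AlgebraicGeometry.HodgeTheory Literature.Barriers.HodgeConjecture
open Summit.HodgeConjecture.HodgeConjecture.Theses.NoetherLefschetzOneUp
open RegimeSplit

/-! ### Levels below `m` ⟹ the Hodge conjecture below dimension `2m` -/

/-- **The middle levels `< m` give the Hodge conjecture in every dimension `< 2m`**, in the spelling
`RegimeSplit.HodgeBelowDim (2m)`: verbatim `Theorems.stub_hodgeBelowLevel` (BFNP Lemma 48 truncated
at level `m`: pencil step below the middle, the granted levels in the middle, hard Lefschetz above).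
[cite: BrosnanFangNiePearlstein2009, §6 Lemma 48] -/
theorem hodgeBelowDim_of_levelsBelow {m : ℕ}
    (ih : ∀ m' : ℕ, m' < m → ∀ ⦃X : SchemeOver ℂ⦄, IsSmoothProjective (2 * m') X →
      ∀ c : complexBetti X (2 * m'), IsRationalClass c → IsOfHodgeType (2 * m') X (2 * m') m' m' c →
        c ∈ algebraicClasses X m') :
    HodgeBelowDim (2 * m) :=
  fun _ _ hn hY p c hc hh ↦ stub_hodgeBelowLevel ih hn hY p c hc hh

/-- **HC(4;2,2) gives every middle level `< 3`**: level `0` is `algebraicClasses_zero`, level `1`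
is Lefschetz `(1,1)` (`LefschetzOneOne_holds`), level `2` is the hypothesis. [cite: Deligne2000, §1] -/
theorem levelsBelow_three_of_hc42
    (h42 : ∀ ⦃X : SchemeOver ℂ⦄, IsSmoothProjective 4 X → ∀ c : complexBetti X (2 * 2),
      IsRationalClass c → IsOfHodgeType 4 X (2 * 2) 2 2 c → c ∈ algebraicClasses X 2) :
    ∀ m' : ℕ, m' < 3 → ∀ ⦃X : SchemeOver ℂ⦄, IsSmoothProjective (2 * m') X →
      ∀ c : complexBetti X (2 * m'), IsRationalClass c → IsOfHodgeType (2 * m') X (2 * m') m' m' c →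
        c ∈ algebraicClasses X m' := by
  intro m' hm'
  interval_cases m'
  · intro X _ c _ _
    rw [algebraicClasses_zero]
    exact Submodule.mem_top
  · exact fun X hX c hc hpp ↦ LefschetzOneOne_holds hX c hc hpp
  · exact fun X hX c hc hpp ↦ h42 hX c hc hpp

/-- **HC(4;2,2) gives the Hodge conjecture in every dimension `≤ 5`** (`HodgeBelowDim 6`).
[cite: BrosnanFangNiePearlstein2009, §6 Lemma 48] -/
theorem hodgeBelowDim_six_of_hc42
    (h42 : ∀ ⦃X : SchemeOver ℂ⦄, IsSmoothProjective 4 X → ∀ c : complexBetti X (2 * 2),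
      IsRationalClass c → IsOfHodgeType 4 X (2 * 2) 2 2 c → c ∈ algebraicClasses X 2) :
    HodgeBelowDim 6 :=
  hodgeBelowDim_of_levelsBelow (m := 3) (levelsBelow_three_of_hc42 h42)

/-! ### The sector theorem `ChowDegenerateRung` of the card -/

/-- **`ChowDegenerateRung` — at every level `m ≥ 2`, granted the levels `< m`, the Hodge conjecture
holds in the middle degree of every smooth projective `2m`-fold with degenerate `CH₀`** (Voisin II
Prop. 10.26 one level up, for all levels at once): `Theorems.middleStepChowDegenerate_holds` fed with
`hodgeBelowDim_of_levelsBelow`. Its `m = 2` instance is Prop. 10.26 itself (Conte–Murre,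
Bloch–Srinivas). [cite: VoisinHodgeII2003, Prop. 10.26] [cite: BlochSrinivas1983, Thm. 1] -/
theorem middle_mem_algebraicClasses_of_chowZeroDegenerate_of_levelsBelow {m : ℕ} (hm : 2 ≤ m)
    (ih : ∀ m' : ℕ, m' < m → ∀ ⦃X : SchemeOver ℂ⦄, IsSmoothProjective (2 * m') X →
      ∀ c : complexBetti X (2 * m'), IsRationalClass c → IsOfHodgeType (2 * m') X (2 * m') m' m' c →
        c ∈ algebraicClasses X m')
    {X : SchemeOver ℂ} (hX : IsSmoothProjective (2 * m) X) (hW : ChowZeroDegenerate X)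
    (c : complexBetti X (2 * m)) (hc : IsRationalClass c) (hh : IsOfHodgeType (2 * m) X (2 * m) m m c) :
    c ∈ algebraicClasses X m :=
  middleStepChowDegenerate_holds hm hX (hodgeBelowDim_of_levelsBelow ih) hW c hc hh

/-- **`CH₀` supported in dimension `≤ d < dim X` ⟹ `CH₀(X)` degenerate**: the barrier catalogue's
`HasChowZeroSupportedInDimLE X d` (a closed `W` all of whose points have dimension `≤ d` carries every
`0`-cycle up to rational equivalence) gives `RegimeSplit.ChowZeroDegenerate X` for `X` smooth
projective of dimension `n > d`, because `W ≠ X`: the generic point of `X` has dimension `n`.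
[cite: VoisinHodgeII2003, Cor. 10.21] -/
theorem chowZeroDegenerate_of_hasChowZeroSupportedInDimLE {n d : ℕ} {X : SchemeOver ℂ}
    (hX : IsSmoothProjective n X) (hd : d < n) (h : HasChowZeroSupportedInDimLE X d) :
    ChowZeroDegenerate X := by
  obtain ⟨W, hW, hdim, hsurj⟩ := h
  refine ⟨W, hW, ?_, hsurj⟩
  haveI := irreducibleSpace_of_isSmoothProjective' hX
  intro hWu
  -- the generic point `ξ` of `X` lies in `W = X`, but has dimension `n > d`
  have hξW : genericPoint X.left ∈ W := hWu ▸ Set.mem_univ _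
  have hle := hdim _ hξW
  obtain ⟨a, b, ha, hb, hab⟩ := exists_height_eq_coheight_eq hX (genericPoint X.left)
  have h0 : Order.coheight (genericPoint X.left) = 0 :=
    Order.coheight_eq_zero.2 fun y _ ↦ Scheme.le_iff_specializes.2 (genericPoint_specializes y)
  rw [h0] at hb
  have hb0 : b = 0 := by exact_mod_cast hb.symm
  rw [ha] at hle
  have han : a ≤ d := by exact_mod_cast hle
  omega

/-! ### Granted HC(4;2,2): the Hodge conjecture for CH₀-degenerate sixfolds -/

/-- **Granted HC(4;2,2), the Hodge conjecture holds for every smooth projective complex SIXFOLD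
with degenerate `CH₀`** — all uniruled, rationally connected and Fano sixfolds, every product with a
CH₀-degenerate factor, everything dominated by these (given the Chow-theoretic input
`ChowZeroDegenerate`): HC in dimensions `≤ 5` from HC(4;2,2) (`hodgeBelowDim_six_of_hc42`), the
middle degree by the CH₀-degenerate regime (`middleStepChowDegenerate_holds`), the other degrees by
the pencil step / hard Lefschetz (`hodgeConjectureFor_of_hodgeBelowDim_of_middle`).
[cite: VoisinHodgeII2003, Prop. 10.26] [cite: ConteMurre1978] [cite: BlochSrinivas1983, Thm. 1] -/
theorem hodgeConjectureFor_six_of_hc42_of_chowZeroDegenerate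
    (h42 : ∀ ⦃X : SchemeOver ℂ⦄, IsSmoothProjective 4 X → ∀ c : complexBetti X (2 * 2),
      IsRationalClass c → IsOfHodgeType 4 X (2 * 2) 2 2 c → c ∈ algebraicClasses X 2)
    {X : SchemeOver ℂ} (hX : IsSmoothProjective 6 X) (hW : ChowZeroDegenerate X) :
    HodgeConjectureFor 6 X :=
  hodgeConjectureFor_of_hodgeBelowDim_of_middle (hodgeBelowDim_six_of_hc42 h42) hX
    fun q _ hq6 c hc hh ↦ by
      obtain rfl : q = 3 := by omega
      exact middleStepChowDegenerate_holds (by norm_num) hX (hodgeBelowDim_six_of_hc42 h42) hW c hc hh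

/-- **Granted HC(4;2,2), the Hodge conjecture holds for every smooth hypersurface sixfold
`X ⊂ ℙ⁷_ℂ` of degree `1 ≤ e ≤ 6`** — quadric, cubic, quartic, quintic and sextic sixfolds: a line
through every point (Esnault–Levine–Viehweg Lemma 4.2 a)) puts `CH₀(X)` on a hyperplane section
(`hasChowZeroSupportedInDimLE_of_isSmoothHypersurface`, dimension `≤ 5`), so `CH₀(X)` is degenerate
and `hodgeConjectureFor_six_of_hc42_of_chowZeroDegenerate` applies.
[cite: VoisinHodgeII2003, Prop. 10.26 and the remark following it (§10.2.3)]
[cite: EsnaultLevineViehweg1997, Lemma 4.2 a)] -/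
theorem hodgeConjectureFor_six_of_hc42_of_isSmoothHypersurface
    (h42 : ∀ ⦃X : SchemeOver ℂ⦄, IsSmoothProjective 4 X → ∀ c : complexBetti X (2 * 2),
      IsRationalClass c → IsOfHodgeType 4 X (2 * 2) 2 2 c → c ∈ algebraicClasses X 2)
    {e : ℕ} {X : SchemeOver ℂ} (hX : IsSmoothHypersurface 6 e X) (he : 0 < e) (he6 : e ≤ 6) :
    HodgeConjectureFor 6 X :=
  hodgeConjectureFor_six_of_hc42_of_chowZeroDegenerate h42 hX.1
    (chowZeroDegenerate_of_hasChowZeroSupportedInDimLE hX.1 (by norm_num)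
      (hasChowZeroSupportedInDimLE_of_isSmoothHypersurface hX he he6))

/-! ### The crux is the heart of the middle step from level 3 on -/

/-- **`SummitGrantedFourfolds` ↔ the heart of the middle step from level 3 on.** The crux
(`HC(4;2,2) → HodgeConjecture`) is EQUIVALENT to: for every `q ≥ 3` and every smooth projective
complex `2q`-fold `X` whose `CH₀` is NOT degenerate, the Hodge conjecture in all dimensions `< 2q`
implies that every rational `(q,q)`-class on `X` is algebraic. (→): at `q ≥ 3` the hypothesis
`HodgeBelowDim (2q)` contains HC(4;2,2), and the crux turns it into the whole Hodge conjecture.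
(←): `hodgeConjecture_iff_heart` — the heart at `q = 2` is HC(4;2,2) itself, at `q ≥ 3` the
hypothesis; the CH₀-degenerate regime and the reduction to the middle step are theorems. What is
open of the crux is exactly this heart (general Weil-type abelian sixfolds at `q = 3`).
[cite: VoisinHodgeII2003, Thm. 10.17 and Prop. 10.26] [cite: KerrPearlstein2011, §3.1] [cite: Deligne2000, §1] -/
theorem summitGrantedFourfolds_iff_heartFromThree :
    Summit.HodgeConjecture.HodgeConjecture.Theses.NoetherLefschetzOneUp.SummitGrantedFourfolds ↔ ∀ ⦃q : ℕ⦄ ⦃X : Literature.AlgebraicGeometry.Motives.SchemeOver ℂ⦄, 3 ≤ q → Literature.AlgebraicGeometry.Motives.IsSmoothProjective (2 * q) X → Summit.HodgeConjecture.HodgeConjecture.Theorems.RegimeSplit.HodgeBelowDim (2 * q) → ¬ Summit.HodgeConjecture.HodgeConjecture.Theorems.RegimeSplit.ChowZeroDegenerate X → ∀ c : Literature.AlgebraicGeometry.HodgeTheory.complexBetti X (2 * q), Literature.AlgebraicGeometry.HodgeTheory.IsRationalClass c → Literature.AlgebraicGeometry.HodgeTheory.IsOfHodgeType (2 * q) X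 (2 * q) q q c → c ∈ Literature.AlgebraicGeometry.HodgeTheory.algebraicClasses X q := by
  constructor
  · intro hS q X hq hX ih _ c hc hh
    -- level 2 of the dimension hypothesis is HC(4;2,2)
    have h42 : ∀ ⦃Y : SchemeOver ℂ⦄, IsSmoothProjective 4 Y → ∀ c : complexBetti Y (2 * 2),
        IsRationalClass c → IsOfHodgeType 4 Y (2 * 2) 2 2 c → c ∈ algebraicClasses Y 2 :=
      fun Y hY c' hc' hh' ↦ ih (show 4 < 2 * q by omega) hY 2 c' hc' hh'
    exact (hS h42 hX).2 q c hc hh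
  · intro hH
    unfold Summit.HodgeConjecture.HodgeConjecture.Theses.NoetherLefschetzOneUp.SummitGrantedFourfolds
    intro h42
    have hHC : _root_.HodgeConjecture := by
      refine hodgeConjecture_iff_heart.2 ?_
      intro q X hq hX ih hnd c hc hh
      rcases hq.eq_or_lt with h2 | h3
      · subst h2
        exact h42 hX c hc hh
      · exact hH h3 hX ih hnd c hc hh
    intro n X hX
    exact ⟨(hHC hX).1, (hHC hX).2⟩

/-! ### The line's composition, with its two registered stubs as hypotheses -/

/-- **Transfer → supply → crux** (the composition `SummitGrantedFourfolds_of` of line `Sketch`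
with its registered stubs `stub_oneSidedRung` (transfer) and `stub_oneSidedSupply` (supply on the
heart) as hypotheses; no `sorry`, no named fact). Granted HC(4;2,2): `hodgeConjecture_iff_heart`
reduces the Hodge conjecture to the heart; at `q = 2` the heart is the hypothesis; at `q ≥ 3` the
supply gives a one-sided Hodge-fixing pair `k • c = [Z']^* c + [Z'']^* c` over the unconditional
Gysin formalism of the complex orientations
(`exists_gysinFormalism_isGysinHodgeCompatible_complexOrientation_holds`) and the transfer makes `c`
algebraic. [cite: VoisinHodgeII2003, Prop. 10.26] [cite: KerrPearlstein2011, §3.1] -/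
theorem summitGrantedFourfolds_of_transfer_of_supply
    (hR : ∀ (G : GysinFormalism), G.IsGysinHodgeCompatible →
      ∀ ⦃q : ℕ⦄ ⦃X : SchemeOver ℂ⦄ (_ : 2 ≤ q) (hX : IsSmoothProjective (2 * q) X),
        HodgeBelowDim (2 * q) → ∀ c : complexBetti X (2 * q), IsRationalClass c →
          IsOfHodgeType (2 * q) X (2 * q) q q c →
          (∃ (k : ℕ) (T W : Set X.left) (Z' Z'' : ↥(cyclesOfDim (X ⊗ X).left (2 * q))),
              0 < k ∧ IsClosed T ∧ T ≠ Set.univ ∧ IsClosed W ∧ W ≠ Set.univ ∧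
              (∀ z, (Z' : AlgebraicCycle (X ⊗ X).left ℤ) z ≠ 0 → (fst X X).left.base z ∈ T) ∧
              (∀ z, (Z'' : AlgebraicCycle (X ⊗ X).left ℤ) z ≠ 0 → (snd X X).left.base z ∈ W) ∧
              (k : ℂ) • c = G.corrAct hX hX (2 * q) Z' c + G.corrAct hX hX (2 * q) Z'' c) →
          c ∈ algebraicClasses X q)
    (hS : ∀ (G : GysinFormalism), G.IsGysinHodgeCompatible →
      ∀ ⦃q : ℕ⦄ ⦃X : SchemeOver ℂ⦄ (_ : 3 ≤ q) (hX : IsSmoothProjective (2 * q) X),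
        HodgeBelowDim (2 * q) → ¬ ChowZeroDegenerate X → ∀ c : complexBetti X (2 * q),
          IsRationalClass c → IsOfHodgeType (2 * q) X (2 * q) q q c →
          ∃ (k : ℕ) (T W : Set X.left) (Z' Z'' : ↥(cyclesOfDim (X ⊗ X).left (2 * q))),
            0 < k ∧ IsClosed T ∧ T ≠ Set.univ ∧ IsClosed W ∧ W ≠ Set.univ ∧
            (∀ z, (Z' : AlgebraicCycle (X ⊗ X).left ℤ) z ≠ 0 → (fst X X).left.base z ∈ T) ∧
            (∀ z, (Z'' : AlgebraicCycle (X ⊗ X).left ℤ) z ≠ 0 → (snd X X).left.base z ∈ W) ∧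
            (k : ℂ) • c = G.corrAct hX hX (2 * q) Z' c + G.corrAct hX hX (2 * q) Z'' c) :
    Summit.HodgeConjecture.HodgeConjecture.Theses.NoetherLefschetzOneUp.SummitGrantedFourfolds := by
  refine summitGrantedFourfolds_iff_heartFromThree.2 fun q X hq hX ih hnd c hc hh ↦ ?_
  obtain ⟨G, hG⟩ := exists_gysinFormalism_isGysinHodgeCompatible_complexOrientation_holds
  exact hR G hG (by omega) hX ih c hc hh (hS G hG hq hX ih hnd c hc hh)

end Summit.HodgeConjecture.HodgeConjecture.Theorems

end
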